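import Mathlib
import HarnessLib
import HarnessLib.Audit
import Summits.KontsevichZagierPeriods.Statement
import Summits.KontsevichZagierPeriods.KontsevichZagierPeriods.Theses.SymplecticScissors

/-!
# Record of the dropped route items `SymplecticScissors.PeriodConjectureCurveType` (stmt-KontsevichZagierPeriods-14055) and `SymplecticScissors.CurvePeriodsTransfer` (stmt-KontsevichZagierPeriods-11129)

Route `KontsevichZagierPeriods/SymplecticScissors` lost its support items `PeriodConjectureCurveType`
(stmt-KontsevichZagierPeriods-14055) and `CurvePeriodsTransfer` (stmt-KontsevichZagierPeriods-11129)
on 2026-08-16T14:16:23Z to the items-cap LINT AUTOFIX (`cone.unused` supports dropped to fit;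
both items closed `moot`; "restore with `route edit --add-items` if wanted"). The gate-written route
file `Theses/SymplecticScissors.lean` therefore no longer declares the two constants, while three
Theorems files — append-only, whose statement texts may not change — still name them and stopped
building (full builds of 2026-08-16T19:45Z and 23:33Z, "Unknown identifier"):
`Theorems/SymplecticScissorsCurvePeriodsTransferThetaPsi.lean` (`curvePeriodsTransfer_of_theta_psi`,
`helper_assembly_theta_psi`: conclusion `…Theses.SymplecticScissors.CurvePeriodsTransfer`),
`Theorems/SymplecticScissorsRealOnePeriodRelations.lean`
(`RealOnePeriodRelations_of_periodConjectureCurveType`, `helper_final_conditional`: hypothesis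
`…Theses.SymplecticScissors.PeriodConjectureCurveType`) and, through the latter,
`Theorems/SymplecticScissorsCurvePeriodsTransfer.lean` (`curvePeriodsTransfer_proof`, the former
closing file of 11129). This module re-declares the two constants under their ORIGINAL fully-qualified
names with their ledger signatures VERBATIM as definientia, in the route file's namespace and `open`
context, so that those records elaborate again with one added `import` line each (pattern
`Summits/AnomalousDissipation/AnomalousDissipation/Theorems/DebrisQuantaRobustDecayQuantumRecord.lean`).
Neither constant is a route item (no `route_item` attribute). Definitional bookkeeping, checked when
this module was written: the signature of 11129 is literally `(<signature of 14055>) → <body of the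
live route item RealOnePeriodRelations>`, and the signature of 14055 is the body of the Literature
named fact `Literature.NumberTheory.Transcendental.HuberWustholzCurvePeriods` up to `δ`, so
`CurvePeriodsTransfer` still unfolds to `PeriodConjectureCurveType → RealOnePeriodRelations` and the
landed proofs (`unfold …; intro hHW c hc heval`, `:= RealOnePeriodRelations_of_periodConjectureCurveType`)
typecheck unchanged. Mathematically: `PeriodConjectureCurveType` is the Huber–Wüstholz theorem for
periods of curve type (HW 2022, Thm 13.3 (2)) in the tree's elementary rendering — a named fact, not
proved here; `CurvePeriodsTransfer` is the implication "that theorem ⇒ `RealOnePeriodRelations`",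
which IS proved in the tree (`curvePeriodsTransfer_proof`).
-/

namespace Summit.KontsevichZagierPeriods.KontsevichZagierPeriods.Theses.SymplecticScissors

open scoped BigOperators Topology Manifold Classical MeasureTheory ProbabilityTheory Matrix InnerProductSpace ComplexConjugate ContinuousMap
open Filter Set Function TopologicalSpace MeasureTheory
open Literature Periods

/-- **Record of the dropped route item `PeriodConjectureCurveType`** =
stmt-KontsevichZagierPeriods-14055 (ledger signature verbatim; NOT a route item; a named fact of the
literature, proved in the tree for genus `0` and for one non-CM elliptic curve only): Kontsevich's period conjecture for
periods of curve type = Huber–Wüstholz 2022, Thm 13.3 (2), in the elementary rendering of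
`Literature/NumberTheory/Transcendental/CurvePeriods.lean` — every finitely supported family of
algebraic coefficients `c` on period symbols `s = (Z, ω, γ)` with `Σ_s c_s ∫_{γ_s} ω_s = 0` is a
`ℚ̄`-linear combination of elementary relations (R1 add/smul, R2 vanish, R3 exact, R4 pushforward,
R5 triangle boundary); `δ`-equal to `Literature.NumberTheory.Transcendental.HuberWustholzCurvePeriods`.
Re-declared only so that the records naming it keep elaborating (see the module docstring; no
citation tag on purpose: this is a record of a dropped route constant, not a vendored literature
fact). -/
def PeriodConjectureCurveType : Prop :=
  ∀ c : Literature.NumberTheory.Transcendental.CurvePeriods.PeriodSymbol →₀ ℂ, (∀ s, IsAlgebraic ℚ (c s)) → Literature.NumberTheory.Transcendental.CurvePeriods.evalCombination c = 0 → ∃ (k : ℕ) (ρ : Fin k → (Literature.NumberTheory.Transcendental.CurvePeriods.PeriodSymbol →₀ ℂ)) (a : Fin k → ℂ), (∀ l, Literature.NumberTheory.Transcendental.CurvePeriods.IsElementaryRelation (ρ l)) ∧ (∀ l, IsAlgebraic ℚ (a l)) ∧ c = ∑ l, a l • ρ l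

/-- **Record of the dropped route item `CurvePeriodsTransfer`** = stmt-KontsevichZagierPeriods-11129
(ledger signature verbatim; NOT a route item; TRUE — `Theorems.…CurvePeriodsTransfer.curvePeriodsTransfer_proof`):
the Huber–Wüstholz theorem for curve-type periods (the antecedent, = `PeriodConjectureCurveType`)
implies that every `ℤ`-relation among effective one-dimensional Kontsevich–Zagier integral
representations lies in the subgroup generated by domain additivity (1a), integrand additivity (1b),
change of variables (2) and the semialgebraic Green generator (the consequent, = the live route item
`RealOnePeriodRelations`, verbatim). Re-declared only so that the records naming it keep elaborating
(see the module docstring; no citation tag on purpose). -/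
def CurvePeriodsTransfer : Prop :=
  (∀ c : Literature.NumberTheory.Transcendental.CurvePeriods.PeriodSymbol →₀ ℂ, (∀ s, IsAlgebraic ℚ (c s)) → Literature.NumberTheory.Transcendental.CurvePeriods.evalCombination c = 0 → ∃ (k : ℕ) (ρ : Fin k → (Literature.NumberTheory.Transcendental.CurvePeriods.PeriodSymbol →₀ ℂ)) (a : Fin k → ℂ), (∀ l, Literature.NumberTheory.Transcendental.CurvePeriods.IsElementaryRelation (ρ l)) ∧ (∀ l, IsAlgebraic ℚ (a l)) ∧ c = ∑ l, a l • ρ l) → ∀ c : Literature.NumberTheory.Transcendental.KZ.FormalRep, c ∈ AddSubgroup.closure (Set.range fun r : Literature.NumberTheory.Transcendental.KZ.IntegralRep 1 => Literature.NumberTheory.Transcendental.KZ.of r) → Literature.NumberTheory.Transcendental.KZ.eval c = 0 → c ∈ AddSubgroup.closure (Literature.NumberTheory.Transcendental.KZ.domainAddRel ∪ Literature.NumberTheory.Transcendental.KZ.integrandAddRel ∪ Literature.NumberTheory.Transcendental.KZ.changeOfVariablesRel ∪ {g : Literature.NumberTheory.Transcendental.KZ.FormalRep | ∃ (Δ : Set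 (Fin 2 → ℝ)) (A B S : (Fin 2 → ℝ) → ℝ) (r₀₁ r₁₂ r₀₂ : Literature.NumberTheory.Transcendental.KZ.IntegralRep 1), Δ = {p | 0 ≤ p 0 ∧ 0 ≤ p 1 ∧ p 0 + p 1 ≤ 1} ∧ Literature.NumberTheory.Transcendental.IsSemialgebraicFunOn ℚ Δ A ∧ Literature.NumberTheory.Transcendental.IsSemialgebraicFunOn ℚ Δ B ∧ ContinuousOn A Δ ∧ ContinuousOn B Δ ∧ (∀ p : Fin 2 → ℝ, 0 < p 0 → 0 < p 1 → p 0 + p 1 < 1 → HasFDerivAt S (A p • ContinuousLinearMap.proj (R := ℝ) (φ := fun _ : Fin 2 => ℝ) 0 + B p • ContinuousLinearMap.proj (R := ℝ) (φ := fun _ : Fin 2 => ℝ) 1) p) ∧ r₀₁.domain = {z | z 0 ∈ Set.Ioo 0 1} ∧ r₁₂.domain = {z | z 0 ∈ Set.Ioo 0 1} ∧ r₀₂.domain = {z | z 0 ∈ Set.Ioo 0 1} ∧ (∀ z ∈ r₀₁.domain, r₀₁.integrand z = A ![z 0, 0]) ∧ (∀ z ∈ r₁₂.domain, r₁₂.integrand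 z = B ![1 - z 0, z 0] - A ![1 - z 0, z 0]) ∧ (∀ z ∈ r₀₂.domain, r₀₂.integrand z = B ![0, z 0]) ∧ g = Literature.NumberTheory.Transcendental.KZ.of r₀₁ + Literature.NumberTheory.Transcendental.KZ.of r₁₂ - Literature.NumberTheory.Transcendental.KZ.of r₀₂})

/-- **Definitional bookkeeping of the record** (registered anchor
`helper_curvePeriodsTransfer_record_iff` of stmt-KontsevichZagierPeriods-11129): the re-declared
constant `CurvePeriodsTransfer` unfolds to `PeriodConjectureCurveType → RealOnePeriodRelations`
(the live route item), exactly as the dropped route declaration did — so the landed records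
`curvePeriodsTransfer_of_theta_psi` (`unfold …; intro hHW c hc heval`) and
`curvePeriodsTransfer_proof := RealOnePeriodRelations_of_periodConjectureCurveType` typecheck
unchanged once they import this module. [folklore] -/
theorem helper_curvePeriodsTransfer_record_iff : Summit.KontsevichZagierPeriods.KontsevichZagierPeriods.Theses.SymplecticScissors.CurvePeriodsTransfer ↔ (Summit.KontsevichZagierPeriods.KontsevichZagierPeriods.Theses.SymplecticScissors.PeriodConjectureCurveType → Summit.KontsevichZagierPeriods.KontsevichZagierPeriods.Theses.SymplecticScissors.RealOnePeriodRelations) :=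
  Iff.rfl

end Summit.KontsevichZagierPeriods.KontsevichZagierPeriods.Theses.SymplecticScissors
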